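import Mathlib
import Summits.ValiantsHypothesis.ValiantsHypothesis.Theses.SliceSignRank
import Literature.Computability.AlgebraicComplexity.DeterminantalComplexityProofs
import Literature.Computability.AlgebraicComplexity.VPDeterminantalQPProofs

/-!
# Birth skeleton (BC3) for crux `PositiveSliceNormalForm` (FNF⁺) of route `SliceSignRank`

Crux (item stmt-ValiantsHypothesis-15119, route-ValiantsHypothesis-SliceSignRank, rank 3):
every VP_ℂ family supported on the permutation slice with all permutation coefficients real and
positive has, for all `n ≥ 1`, a REAL fermionic normal form of quasi-polynomial length
`coeff(x^σ, f_n) = sgn σ · Σ_{t<k} Π_i W_t(σ i, i)`, `W_t ∈ ℝ^{n×n}`, `k ≤ 2^((log₂ n + c)^c)`.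

The line separates the two fields the crux mixes (circuits live over ℂ, the sign-rank engine
over ℝ) and moves the algebraic half onto the concrete object VP hands us for free:

* `stub_detSliceComplexNF` (load-bearing, open) — COMPLEX fermionic normal form for positive slice
  families of quasi-polynomial DETERMINANTAL complexity: if every `f_n = det A_n` with `A_n` an
  affine `m(n) × m(n)` matrix, `m` qp-bounded (`HasDetRepr`), and `f` is slice-supported with positive
  real permutation coefficients, then `coeff(x^σ, f_n) = sgn σ · Σ_{t<k} Π_i Z_t(σ i, i)` with COMPLEX
  twists `Z_t` and `k` qp-bounded. (VP ⇒ qp-bounded dc is the tree theorem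
  `isQPBounded_determinantalComplexity_of_isVPFamily_holds`, used in the assembly, so the stub is
  the crux over ℂ for VQP = qp-projections of DET; slice-supportedness stays in the hypothesis —
  without it the statement would give tdr_ℂ(per_n) quasi-polynomial.)
* `stub_realDescent` (true, M-sized: Lagrange interpolation in the pencil `A + sB`) — a REAL-valued
  function of the form `sgn σ · Σ_{t<k} Π_i Z_t(σ i, i)` with complex `Z_t = A_t + iB_t` is of the same
  form with `k(n+1)` REAL twists: `Re Π_i (A + iB)(σ i, i) = Σ_{m ≤ n} Re ℓ_m(i) · Π_i (A + s_m B)(σ i, i)`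
  for any `n+1` distinct real nodes `s_m` (Lagrange basis `ℓ_m`), and the real scalar is absorbed into
  column `0` of the twist (needs `n ≥ 1`).
* `PositiveSliceNormalForm_of_stubs` — the kernel-checked composition (no sorry; stub statements as
  hypotheses, the crux body verbatim as conclusion): tree theorem (VP ⇒ qp dc, attained representation)
  → stub 1 → stub 2 at the real coefficient function → `k(n+1) ≤ 2^((log₂ n + c + 2)^(c+2))`;
  `PositiveSliceNormalForm_of : PositiveSliceNormalForm` concludes the crux BY NAME from the two stubs.
-/

namespace Summit.ValiantsHypothesis.ValiantsHypothesis.Cruxes.PositiveSliceNormalForm.Birth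

open Literature.Computability.AlgebraicComplexity
open Summit.ValiantsHypothesis.ValiantsHypothesis.Theses.SliceSignRank

/-- STUB 1 (load-bearing, open): complex fermionic normal form for positive slice families of
quasi-polynomial determinantal complexity. -/
theorem stub_detSliceComplexNF :
    ∀ f : (n : ℕ) → MvPolynomial (Fin n × Fin n) ℂ,
      (∀ (n : ℕ) (d : Fin n × Fin n →₀ ℕ), (∀ ρ : Equiv.Perm (Fin n), permMonomial ρ ≠ d) →
          MvPolynomial.coeff d (f n) = 0) →
      (∀ (n : ℕ) (ρ : Equiv.Perm (Fin n)), ∃ r : ℝ, 0 < r ∧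
          MvPolynomial.coeff (permMonomial ρ) (f n) = (r : ℂ)) →
      (∃ c : ℕ, ∀ n : ℕ, HasDetRepr (f n) (2 ^ ((Nat.log 2 n + c) ^ c))) →
      ∃ c : ℕ, ∀ n : ℕ, 1 ≤ n → ∃ k ≤ 2 ^ ((Nat.log 2 n + c) ^ c),
        ∃ Z : Fin k → Matrix (Fin n) (Fin n) ℂ, ∀ σ : Equiv.Perm (Fin n),
          MvPolynomial.coeff (permMonomial σ) (f n) =
            ((Equiv.Perm.sign σ : ℤ) : ℂ) * ∑ t, ∏ i, Z t (σ i) i := by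
  sorry

/-- STUB 2 (true; Lagrange interpolation in the pencil `A + sB`, scalar absorbed in column 0):
real descent of fermionic sums with real values, length `k ↦ k(n+1)`. -/
theorem stub_realDescent :
    ∀ (n k : ℕ), 1 ≤ n → ∀ (Z : Fin k → Matrix (Fin n) (Fin n) ℂ) (a : Equiv.Perm (Fin n) → ℝ),
      (∀ σ : Equiv.Perm (Fin n),
          (a σ : ℂ) = ((Equiv.Perm.sign σ : ℤ) : ℂ) * ∑ t, ∏ i, Z t (σ i) i) →
      ∃ W : Fin (k * (n + 1)) → Matrix (Fin n) (Fin n) ℝ, ∀ σ : Equiv.Perm (Fin n),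
        (a σ : ℂ) = ((Equiv.Perm.sign σ : ℤ) : ℂ) * ∑ t, ∏ i, ((W t (σ i) i : ℝ) : ℂ) := by
  sorry

/-- Quasi-polynomial bookkeeping: `k ≤ 2^((log₂ n + c)^c)` gives
`k(n+1) ≤ 2^((log₂ n + c + 2)^(c+2))`. -/
theorem qp_mul_succ_le {n k c : ℕ} (hk : k ≤ 2 ^ ((Nat.log 2 n + c) ^ c)) :
    k * (n + 1) ≤ 2 ^ ((Nat.log 2 n + (c + 2)) ^ (c + 2)) := by
  set L := Nat.log 2 n with hL
  have hn : n + 1 ≤ 2 ^ (L + 1) := Nat.lt_pow_succ_log_self one_lt_two n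
  have h1 : (L + c) ^ c ≤ (L + c + 2) ^ c := Nat.pow_le_pow_left (by omega) c
  have h2 : 1 ≤ (L + c + 2) ^ c := Nat.one_le_pow _ _ (by omega)
  have key : (L + c) ^ c + (L + 1) ≤ (L + (c + 2)) ^ (c + 2) := by
    have h3 : (L + (c + 2)) ^ (c + 2) = (L + c + 2) ^ c * ((L + c + 2) * (L + c + 2)) := by
      rw [show L + (c + 2) = L + c + 2 by omega, pow_add, pow_two]
    have h4 : L + 2 ≤ (L + c + 2) * (L + c + 2) :=
      calc L + 2 ≤ L + c + 2 := by omega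
        _ ≤ (L + c + 2) * (L + c + 2) := Nat.le_mul_of_pos_left _ (by omega)
    have h5 : L + 1 ≤ (L + 1) * (L + c + 2) ^ c := Nat.le_mul_of_pos_right _ h2
    calc (L + c) ^ c + (L + 1) ≤ (L + c + 2) ^ c + (L + 1) * (L + c + 2) ^ c := Nat.add_le_add h1 h5
      _ = (L + c + 2) ^ c * (L + 2) := by ring
      _ ≤ (L + c + 2) ^ c * ((L + c + 2) * (L + c + 2)) := Nat.mul_le_mul_left _ h4
      _ = (L + (c + 2)) ^ (c + 2) := h3.symm
  calc k * (n + 1) ≤ 2 ^ ((L + c) ^ c) * 2 ^ (L + 1) := Nat.mul_le_mul hk hn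
    _ = 2 ^ ((L + c) ^ c + (L + 1)) := (pow_add 2 _ _).symm
    _ ≤ 2 ^ ((L + (c + 2)) ^ (c + 2)) := Nat.pow_le_pow_right (by norm_num) key

/-! ## Assembly (sorry-free) -/

/-- **ASSEMBLY (kernel-checked, no `sorry`).** The two stub statements imply the crux statement
(verbatim the body of `Summit.ValiantsHypothesis.ValiantsHypothesis.Theses.SliceSignRank.PositiveSliceNormalForm`):
VP ⇒ qp-bounded determinantal complexity (tree theorem, attained representation) → stub 1 (complex normal
form) → stub 2 at the real coefficient function chosen from positivity → `k(n+1) ≤ 2^((log₂ n + c + 2)^(c+2))`. -/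
theorem PositiveSliceNormalForm_of_stubs
    (h1 : ∀ f : (n : ℕ) → MvPolynomial (Fin n × Fin n) ℂ,
      (∀ (n : ℕ) (d : Fin n × Fin n →₀ ℕ), (∀ ρ : Equiv.Perm (Fin n), permMonomial ρ ≠ d) →
          MvPolynomial.coeff d (f n) = 0) →
      (∀ (n : ℕ) (ρ : Equiv.Perm (Fin n)), ∃ r : ℝ, 0 < r ∧
          MvPolynomial.coeff (permMonomial ρ) (f n) = (r : ℂ)) →
      (∃ c : ℕ, ∀ n : ℕ, HasDetRepr (f n) (2 ^ ((Nat.log 2 n + c) ^ c))) →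
      ∃ c : ℕ, ∀ n : ℕ, 1 ≤ n → ∃ k ≤ 2 ^ ((Nat.log 2 n + c) ^ c),
        ∃ Z : Fin k → Matrix (Fin n) (Fin n) ℂ, ∀ σ : Equiv.Perm (Fin n),
          MvPolynomial.coeff (permMonomial σ) (f n) =
            ((Equiv.Perm.sign σ : ℤ) : ℂ) * ∑ t, ∏ i, Z t (σ i) i)
    (h2 : ∀ (n k : ℕ), 1 ≤ n → ∀ (Z : Fin k → Matrix (Fin n) (Fin n) ℂ) (a : Equiv.Perm (Fin n) → ℝ),
      (∀ σ : Equiv.Perm (Fin n),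
          (a σ : ℂ) = ((Equiv.Perm.sign σ : ℤ) : ℂ) * ∑ t, ∏ i, Z t (σ i) i) →
      ∃ W : Fin (k * (n + 1)) → Matrix (Fin n) (Fin n) ℝ, ∀ σ : Equiv.Perm (Fin n),
        (a σ : ℂ) = ((Equiv.Perm.sign σ : ℤ) : ℂ) * ∑ t, ∏ i, ((W t (σ i) i : ℝ) : ℂ)) :
    ∀ f : (n : ℕ) → MvPolynomial (Fin n × Fin n) ℂ,
      (∀ (n : ℕ) (d : Fin n × Fin n →₀ ℕ), (∀ ρ : Equiv.Perm (Fin n), permMonomial ρ ≠ d) →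
          MvPolynomial.coeff d (f n) = 0) →
      (∀ (n : ℕ) (ρ : Equiv.Perm (Fin n)), ∃ r : ℝ, 0 < r ∧
          MvPolynomial.coeff (permMonomial ρ) (f n) = (r : ℂ)) →
      IsVPFamily f →
      ∃ c : ℕ, ∀ n : ℕ, 1 ≤ n → ∃ k ≤ 2 ^ ((Nat.log 2 n + c) ^ c),
        ∃ W : Fin k → Matrix (Fin n) (Fin n) ℝ, ∀ σ : Equiv.Perm (Fin n),
          MvPolynomial.coeff (permMonomial σ) (f n) =
            ((Equiv.Perm.sign σ : ℤ) : ℂ) * ∑ t, ∏ i, ((W t (σ i) i : ℝ) : ℂ) := by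
  intro f hslice hpos hVP
  -- VP ⇒ quasi-polynomially bounded determinantal complexity (tree theorem), attained.
  obtain ⟨c₀, hc₀⟩ := isQPBounded_determinantalComplexity_of_isVPFamily_holds f hVP
  have hdet : ∃ c : ℕ, ∀ n : ℕ, HasDetRepr (f n) (2 ^ ((Nat.log 2 n + c) ^ c)) :=
    ⟨c₀, fun n => (hasDetRepr_iff_determinantalComplexity_le_holds (f n) _).2 (hc₀ n)⟩
  -- complex normal form on the determinantal representation
  obtain ⟨c, hc⟩ := h1 f hslice hpos hdet
  refine ⟨c + 2, fun n hn => ?_⟩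
  obtain ⟨k, hk, Z, hZ⟩ := hc n hn
  -- the coefficient function is real: descend the twists
  choose a ha using hpos n
  have hZ' : ∀ σ : Equiv.Perm (Fin n),
      (a σ : ℂ) = ((Equiv.Perm.sign σ : ℤ) : ℂ) * ∑ t, ∏ i, Z t (σ i) i :=
    fun σ => ((ha σ).2).symm.trans (hZ σ)
  obtain ⟨W, hW⟩ := h2 n k hn Z a hZ'
  exact ⟨k * (n + 1), qp_mul_succ_le hk, W, fun σ => ((ha σ).2).trans (hW σ)⟩

/-- **THE SKELETON THEOREM (registrar shape).** The crux
`Summit.ValiantsHypothesis.ValiantsHypothesis.Theses.SliceSignRank.PositiveSliceNormalForm`, concluded BY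
NAME from the two declared stubs through the sorry-free assembly `PositiveSliceNormalForm_of_stubs`; the only
`sorry`s in its closure are `stub_detSliceComplexNF` and `stub_realDescent`. -/
theorem PositiveSliceNormalForm_of : PositiveSliceNormalForm :=
  PositiveSliceNormalForm_of_stubs stub_detSliceComplexNF stub_realDescent

end Summit.ValiantsHypothesis.ValiantsHypothesis.Cruxes.PositiveSliceNormalForm.Birth
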